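import Literature.AlgebraicGeometry.Resolution.PointBlowupHsFunMono
import Mathlib.AlgebraicGeometry.PullbackCarrier
import Mathlib.AlgebraicGeometry.Morphisms.FiniteType
import Mathlib.RingTheory.Artinian.Module
import HarnessLib

/-!
# [OURS · L1 W4.2] K2-sep ROUTE A, brick (δ2 b): **the fibre of `X ×_k K → X` over a CLOSED point is finite and consists of closed points**
# (`X → Spec k` locally of finite type, `K/k` any field extension: the fibre is `Spec(κ(x) ⊗_{κ(s)} K)` with `κ(x)/k` finite, an artinian
# ring; closedness by the Jacobson property of `X ×_k K`)
# (crux `SigmaMaxModifications` stmt-ResolutionOfSingularities-18506 / conjunct stmt-…-19249; line `w_ladder_rows` v8.5, registered stub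
# `stub_isoSepRecurrent`; res-L1-w42-plan-1 WORD 2026-08-27T16:25:47Z; design `L/res-L1-w42-stub-2/k2sep/K2SEP-DESIGN.md` §8 (δ2)(b))

Prover res-L1-w42-stub-2 (gen 5). Helper file `--supports stmt-ResolutionOfSingularities-19249 --as helper`; no definitions, no named fact. OURS
(cell res-hironaka, slot W4.2); NOT statements of [Hironaka2017] nor of [CossartJannsenSaito2020]. AI-written; AI review is weaker than expert
review. These are the inputs `hfin`, `hcl` of (β3) `isIsolatedInHSMaxLocus_of_hsFun_eq` for `X′ = X ×_k K`.

* `finite_primeSpectrum_tensor_of_isClosed` — for `x` closed, the ring `κ(x) ⊗_{κ(s)} κ(y)` of the unique triplet over `x` is artinian.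
* **`finite_preimage_fst_pullback_SpecMap_of_isClosed`** — `pr₁⁻¹{x}` is finite.
* `isClosed_singleton_of_mem_finite_closed` — in a Jacobson space every point of a finite closed set is closed.
* **`isClosed_singleton_of_fst_eq_of_isClosed`** — every point of `X ×_k K` over a closed point of `X` is closed.

[OURS · L1 W4.2; AI-written] [cite: GrothendieckDieudonne1965, Prop. (4.6.1)] [cite: CossartJannsenSaito2020, Def. 13.3]
-/

set_option linter.dupNamespace false

noncomputable section

open scoped TensorProduct
open CategoryTheory CategoryTheory.Limits AlgebraicGeometry Topology

namespace Summit.ResolutionOfSingularities.ResolutionOfSingularities.Theorems.SigmaMaxModificationsCorridor3.IsoTailsHS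

universe u

/-! ## §1. A point-set lemma: points of a finite closed set of a Jacobson space are closed -/

/-- In a Jacobson space, every point of a FINITE closed subset is a closed point (the closed points of `Z` are dense in `Z`, and a finite
union of closed points is closed). [folklore] -/
theorem isClosed_singleton_of_mem_finite_closed {Y : Type*} [TopologicalSpace Y] [JacobsonSpace Y] {Z : Set Y} (hZ : IsClosed Z)
    (hfin : Z.Finite) {y : Y} (hy : y ∈ Z) : IsClosed ({y} : Set Y) := by
  have hcl : IsClosed (Z ∩ closedPoints Y) := by
    have : Z ∩ closedPoints Y = ⋃ z ∈ (hfin.inter_of_left (closedPoints Y)).toFinset, {z} := by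
      ext z; simp
    rw [this]
    exact isClosed_biUnion_finset fun z hz => ((Set.Finite.mem_toFinset _).mp hz).2
  have h := JacobsonSpace.closure_inter_closedPoints hZ
  rw [hcl.closure_eq] at h
  have hy' : y ∈ Z ∩ closedPoints Y := h.symm ▸ hy
  exact hy'.2

/-! ## §2. The fibre of `X ×_k K → X` over a closed point -/

variable {k K : Type u} [Field k] [Field K] [Algebra k K] {X : Scheme.{u}} (f : X ⟶ Spec (CommRingCat.of k))

/-- For `x` closed in `X` (locally of finite type over `k`) and the unique triplet `T` over `x` of the pullback `X ×_k K`, the ring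
`κ(x) ⊗_{κ(s)} κ(y)` has finite spectrum: `κ(x)` is finite over `κ(s)`, so the tensor product is a finite `κ(y)`-algebra, artinian.
[folklore] -/
theorem finite_primeSpectrum_tensor_of_isClosed [LocallyOfFiniteType f]
    (T : Scheme.Pullback.Triplet f (Spec.map (CommRingCat.ofHom (algebraMap k K)))) (hx : IsClosed ({T.x} : Set X)) :
    Finite ↥(Spec T.tensor) := by
  show Finite (PrimeSpectrum T.tensor)
  -- the two residue field maps as algebras
  let φ := ((Spec (CommRingCat.of k)).residueFieldCongr T.hx).inv ≫ f.residueFieldMap T.x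
  let ψ := ((Spec (CommRingCat.of k)).residueFieldCongr T.hy).inv ≫
    (Spec.map (CommRingCat.ofHom (algebraMap k K))).residueFieldMap T.y
  letI : Algebra ((Spec (CommRingCat.of k)).residueField T.s) (X.residueField T.x) := φ.hom.toAlgebra
  letI : Algebra ((Spec (CommRingCat.of k)).residueField T.s) ((Spec (CommRingCat.of K)).residueField T.y) := ψ.hom.toAlgebra
  -- `κ(x)` is finite over `κ(s)` (closed point, locally of finite type)
  haveI : Module.Finite ((Spec (CommRingCat.of k)).residueField T.s) (X.residueField T.x) := by
    have h1 : (IsLocalRing.ResidueField.map (f.stalkMap T.x).hom).Finite :=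
      Literature.AlgebraicGeometry.Resolution.finite_residueFieldMap_of_isClosed f hx
    have hsurj : Function.Surjective ((Spec (CommRingCat.of k)).residueFieldCongr T.hx).inv.hom := by
      intro b
      refine ⟨((Spec (CommRingCat.of k)).residueFieldCongr T.hx).hom.hom b, ?_⟩
      rw [← RingHom.comp_apply, ← CommRingCat.hom_comp, Iso.hom_inv_id, CommRingCat.hom_id, RingHom.id_apply]
    have h2 : φ.hom.Finite := by
      have : φ.hom = (f.residueFieldMap T.x).hom.comp ((Spec (CommRingCat.of k)).residueFieldCongr T.hx).inv.hom := by
        rfl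
      rw [this]
      exact RingHom.Finite.comp h1 (RingHom.Finite.of_surjective _ hsurj)
    exact h2
  -- the pushout is the tensor product
  have hP := CommRingCat.isPushout_tensorProduct ((Spec (CommRingCat.of k)).residueField T.s) (X.residueField T.x)
    ((Spec (CommRingCat.of K)).residueField T.y)
  let e : CommRingCat.of (X.residueField T.x ⊗[(Spec (CommRingCat.of k)).residueField T.s] (Spec (CommRingCat.of K)).residueField T.y) ≅
      T.tensor := hP.isoPushout
  -- artinian: finite over the field `κ(y)`
  letI : Algebra ((Spec (CommRingCat.of K)).residueField T.y)
      (X.residueField T.x ⊗[(Spec (CommRingCat.of k)).residueField T.s] (Spec (CommRingCat.of K)).residueField T.y) :=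
    Algebra.TensorProduct.rightAlgebra
  haveI : Module.Finite ((Spec (CommRingCat.of K)).residueField T.y)
      (X.residueField T.x ⊗[(Spec (CommRingCat.of k)).residueField T.s] (Spec (CommRingCat.of K)).residueField T.y) := by
    let e' : ((Spec (CommRingCat.of K)).residueField T.y) ⊗[(Spec (CommRingCat.of k)).residueField T.s] X.residueField T.x ≃ₐ[
        (Spec (CommRingCat.of K)).residueField T.y]
        X.residueField T.x ⊗[(Spec (CommRingCat.of k)).residueField T.s] (Spec (CommRingCat.of K)).residueField T.y :=
      AlgEquiv.ofRingEquiv (f := (Algebra.TensorProduct.comm _ _ _).toRingEquiv) fun c => by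
        show Algebra.TensorProduct.comm _ _ _ (algebraMap _ (_ ⊗[_] _) c) = algebraMap _ (_ ⊗[_] _) c
        rw [Algebra.TensorProduct.algebraMap_apply, Algebra.algebraMap_self, RingHom.id_apply]
        simp only [Algebra.TensorProduct.comm_tmul]
        rfl
    exact Module.Finite.equiv e'.toLinearEquiv
  haveI : IsArtinianRing (X.residueField T.x ⊗[(Spec (CommRingCat.of k)).residueField T.s] (Spec (CommRingCat.of K)).residueField T.y) :=
    IsArtinianRing.of_finite ((Spec (CommRingCat.of K)).residueField T.y) _
  haveI : Finite (PrimeSpectrum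
      (X.residueField T.x ⊗[(Spec (CommRingCat.of k)).residueField T.s] (Spec (CommRingCat.of K)).residueField T.y)) := inferInstance
  exact Finite.of_equiv _ (PrimeSpectrum.comapEquiv e.commRingCatIsoToRingEquiv.symm).symm.toEquiv

/-- **The fibre of `pr₁ : X ×_k K → X` over a CLOSED point is FINITE** (all its points correspond, under Mathlib's `Scheme.Pullback.carrierEquiv`,
to the unique triplet over `x` and the finitely many primes of the artinian ring `κ(x) ⊗ K`). [folklore] -/
theorem finite_preimage_fst_pullback_SpecMap_of_isClosed [LocallyOfFiniteType f] {x : X} (hx : IsClosed ({x} : Set X)) :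
    ((pullback.fst f (Spec.map (CommRingCat.ofHom (algebraMap k K)))).base ⁻¹' {x}).Finite := by
  classical
  set g := Spec.map (CommRingCat.ofHom (algebraMap k K)) with hg
  -- the unique triplet over `x`
  let y₀ : ↥(Spec (CommRingCat.of K)) := default
  have hxy : f.base x = g.base y₀ := Subsingleton.elim _ _
  let T₀ : Scheme.Pullback.Triplet f g := Scheme.Pullback.Triplet.mk' x y₀ hxy
  haveI := finite_primeSpectrum_tensor_of_isClosed f T₀ hx
  refine (Set.finite_range fun p : ↥(Spec T₀.tensor) => Scheme.Pullback.carrierEquiv.symm ⟨T₀, p⟩).subset ?_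
  intro t ht
  rw [Set.mem_preimage, Set.mem_singleton_iff] at ht
  obtain ⟨⟨T, p⟩, rfl⟩ := Scheme.Pullback.carrierEquiv.symm.surjective t
  have hT : T = T₀ := by
    refine Scheme.Pullback.Triplet.ext ?_ (Subsingleton.elim _ _)
    show T.x = x
    rw [← ht]
    exact (Scheme.Pullback.carrierEquiv_symm_fst T p).symm
  subst hT
  exact ⟨p, rfl⟩

/-- **Every point of `X ×_k K` over a closed point of `X` is closed** (`X ×_k K` is Jacobson, being locally of finite type over `K`; the fibre is a
finite closed set). [folklore] -/
theorem isClosed_singleton_of_fst_eq_of_isClosed [LocallyOfFiniteType f] {x : X} (hx : IsClosed ({x} : Set X))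
    {x' : ↥(pullback f (Spec.map (CommRingCat.ofHom (algebraMap k K))))}
    (hx' : (pullback.fst f (Spec.map (CommRingCat.ofHom (algebraMap k K)))).base x' = x) :
    IsClosed ({x'} : Set ↥(pullback f (Spec.map (CommRingCat.ofHom (algebraMap k K))))) := by
  haveI : JacobsonSpace ↥(pullback f (Spec.map (CommRingCat.ofHom (algebraMap k K)))) :=
    LocallyOfFiniteType.jacobsonSpace (pullback.snd f (Spec.map (CommRingCat.ofHom (algebraMap k K))))
  refine isClosed_singleton_of_mem_finite_closed (hx.preimage (pullback.fst f _).base.hom.continuous)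
    (finite_preimage_fst_pullback_SpecMap_of_isClosed f hx) ?_
  rw [Set.mem_preimage, hx']; exact Set.mem_singleton x

end Summit.ResolutionOfSingularities.ResolutionOfSingularities.Theorems.SigmaMaxModificationsCorridor3.IsoTailsHS

end
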